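/-
Copyright (c) 2026 the pub-hodgecm-mathlib formalisation cell (harness21).  Prover seat hodgecm-mathlib-K2E1-p03 (g2), Track B ∕ K2-LIT (stream 29),
h413 = `stmt-HodgeConjecture-24833`, line `K2_E1_TraceFormulaBeta`, helper `K2E1RestrictedTensorFixedLevel` (part 1 of the BY-NAME DEAL `K2E1FlathRestrictedLevel` of
K2E1-plan (g0), 2026-09-03T23:08:42Z): the level-`KF` fixed vectors of a RESTRICTED tensor product `⊗'_i ρ_i` are `⨂_{i∈S} V_i^{K'_i}`.  2026-09-03.
-/
import Summits.HodgeConjecture.HodgeConjecture.Theorems.K2E1FixedTensorExhaust     -- ★ p855466 (this seat): `fixedTensorExhaust_holds` (+ ★ p855413 `piTensorRep`, `fixedTensorMap`)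
import Literature.NumberTheory.Automorphic.RestrictedTensorProduct                -- ★ `IsRestrictedTensorProductRep`, `RestrictedFamily.extend`, `liftFinset`
import HarnessLib

/-!
# h413 ∕ Track B «K2-LIT», line `K2_E1_TraceFormulaBeta`, row 18: THE LEVEL-`K_F` FIXED VECTORS OF A RESTRICTED TENSOR PRODUCT `⊗'_i (ρ_i, x₀_i)` ARE `⨂_{i∈S} V_i^{K'_i}`
# (helper `K2E1RestrictedTensorFixedLevel` = part 1 of the BY-NAME DEAL `K2E1FlathRestrictedLevel` of K2E1-plan (g0), `K2/STATUS.md` 2026-09-03T23:08:42Z, road step (1))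

Cell `pub/hodgecm-mathlib`, crux H413 = `stmt-HodgeConjecture-24833`, route `HCCMUnconditional`; chair K2-lead (g0), dealer K2E1-plan (g0).  THEOREMS ONLY (no `def`,
no `instance`, no `notation`, no named-fact hypothesis, no `sorry`; the isomorphism is delivered as `∃ Φ` with its formula); lane `--supports stmt-HodgeConjecture-24833 --as helper`.

CURRENCY (★ `Literature/NumberTheory/Automorphic/RestrictedTensorProduct.lean`, verbatim).  `π` a representation of the restricted product `Πʳ i, [G i, K i]` on `W` with
`IsRestrictedTensorProductRep ρ π hx₀ j S₀` (`j : RestrictedFamily V x₀ → W` restricted-multilinear and equivariant, `hj.liftFinset T : ⨂[ℂ] i:T, V i →ₗ W` injective for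
`T ⊇ S₀`, ranges exhausting `W`); a finite `S ⊇ S₀`; subgroups `K'_i` (`i ∈ S`; the levels of the test functions of part 2); off `S` the `K_i`-fixed space of `ρ_i` is the LINE
`ℂ x₀_i` (`hline`, ★ `IsSpherical`-type with `x₀_i` the spherical vector).  THE LEVEL `K_F := {g | g_i ∈ K'_i (i ∈ S), g_i ∈ K_i (i ∉ S)}`, written WITHOUT a new definition as
`(Subgroup.pi univ (fun i => if i ∈ S then K' i else K i)).comap RestrictedProduct.coeMonoidHom` (`mem_level_iff`).

STATEMENTS.  §1 — the bookkeeping the ★ file defers, PROVED: `range_liftFinset_mono` (the finite pieces increase), `exists_mem_range_liftFinset` (every vector lies in ONE piece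
`T ⊇ S`; directed `iSup`), `map_liftFinset_eq` (equivariance on a finite piece: `π(g) ∘ liftFinset T = liftFinset T ∘ (⊗_{i∈T} ρ_i)(g|_T)` when `g_i ∈ K_i` fixes `x₀_i` off `T`).
§2 — **`exists_fixedEquiv`: `Φ : ⨂[ℂ] i:S, V_i^{K'_i} ≃ₗ W^{K_F}`, `Φ x = liftFinset S (fixedTensorMap x)`** (`S ⊇ S₀`): into `W^{K_F}` by `liftFinset_fixedTensorMap_mem_fixedPoints`,
injective by ★ (`liftFinset S`, `fixedTensorMap`), ONTO by `exists_liftFinset_fixedTensorMap_eq` — a `K_F`-fixed `w` lies in one piece `T ⊇ S`, is fixed there by `Π_{i∈T} L_i`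
(injectivity of `liftFinset T`), hence is `fixedTensorMap` of some `z ∈ ⨂_{i∈T} V_i^{L_i}` by ★ `fixedTensorExhaust_holds` (p855466), and the slots `i ∈ T ∖ S` carry the lines
`ℂ x₀_i`, absorbed into the scalar by multilinearity (`MultilinearMap.map_smul_univ`) and the padding identity `extend T (pad m) = extend S m`.  Part 2 (`K2E1FlathRestrictedLevel`)
transports `π(F)|_{W^{K_F}}` along `Φ` and applies ★ `smoothTrace_eq_prod_of_factorisation`.

HONEST LABEL.  HC_CM is proved only modulo the 7 printed citations (2 remaining named inputs: hLiu418 = `stmt-HodgeConjecture-24832`, h413 = `stmt-HodgeConjecture-24833`)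
until rung 0 closes; this file proves no printed statement of [Rogawski1990] and is count-neutral.

## References
* [FlathCorvallis1979] D. Flath, *Decomposition of representations into tensor products*, Proc. Sympos. Pure Math. 33.1 (1979), §2 (Thm. 2, Example 2).
* [Bump1997] D. Bump, *Automorphic Forms and Representations* (1997), §3.4 (Thm. 3.4.3: `(⊗'π_v)^K = ⊗ π_v^{K_v}`).
-/

set_option autoImplicit false
set_option linter.dupNamespace false  -- the mandated namespace repeats the summit's segment (`HodgeConjecture.HodgeConjecture`)

noncomputable section

namespace Summit.HodgeConjecture.HodgeConjecture.Cruxes.H413.K2E1RestrictedTensorFixedLevel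

open Filter
open scoped TensorProduct RestrictedProduct
open PiTensorProduct Literature.NumberTheory.Automorphic
open Summit.HodgeConjecture.HodgeConjecture.Cruxes.H413.K2E1FixedVectorsTensorFactor
open Summit.HodgeConjecture.HodgeConjecture.Cruxes.H413.K2E1FixedTensorExhaust (fixedTensorExhaust_holds)

/-! ## §1 Restricted tensor products: ranges of `liftFinset` are directed; equivariance on the finite pieces -/

section Bookkeeping

variable {ι : Type} [DecidableEq ι] {V : ι → Type} [∀ i, AddCommGroup (V i)] [∀ i, Module ℂ (V i)] {x₀ : ∀ i, V i}
  {W : Type} [AddCommGroup W] [Module ℂ W] {j : RestrictedFamily V x₀ → W}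

omit [∀ i, AddCommGroup (V i)] [∀ i, Module ℂ (V i)] in
/-- **Padding**: for `T ⊆ T'`, `extend T m = extend T' m'` with `m'` equal to `m` on `T` and to `x₀` on `T' ∖ T`. [cite: FlathCorvallis1979, §2] -/
theorem extend_eq_extend_pad {T T' : Finset ι} (hTT' : T ⊆ T') (m : ∀ i : T, V i) :
    RestrictedFamily.extend (x₀ := x₀) T m =
      RestrictedFamily.extend T' (fun i : T' => if h : (i : ι) ∈ T then m ⟨i, h⟩ else x₀ i) := by
  ext i
  by_cases hi : i ∈ T
  · rw [RestrictedFamily.extend_apply_of_mem _ _ hi, RestrictedFamily.extend_apply_of_mem _ _ (hTT' hi), dif_pos hi]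
  · rw [RestrictedFamily.extend_apply_of_notMem _ _ hi]
    by_cases hi' : i ∈ T'
    · rw [RestrictedFamily.extend_apply_of_mem _ _ hi', dif_neg hi]
    · rw [RestrictedFamily.extend_apply_of_notMem _ _ hi']

/-- **The ranges of `liftFinset` increase with `T`**: `range (liftFinset T) ≤ range (liftFinset T')` for `T ⊆ T'` (pure tensors span; pad with base vectors).
[cite: FlathCorvallis1979, §2] [cite: Bump1997, §3.4] -/
theorem range_liftFinset_mono (hj : IsRestrictedMultilinear ℂ j) {T T' : Finset ι} (hTT' : T ⊆ T') :
    LinearMap.range (hj.liftFinset T) ≤ LinearMap.range (hj.liftFinset T') := by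
  rw [LinearMap.range_eq_map, ← PiTensorProduct.span_tprod_eq_top, Submodule.map_span, Submodule.span_le]
  rintro _ ⟨_, ⟨m, rfl⟩, rfl⟩
  refine ⟨tprod ℂ fun i : T' => if h : (i : ι) ∈ T then m ⟨i, h⟩ else x₀ i, ?_⟩
  rw [IsRestrictedMultilinear.liftFinset_tprod, IsRestrictedMultilinear.liftFinset_tprod, extend_eq_extend_pad hTT']

/-- **Every vector lies in ONE finite piece**: for a restricted tensor product and any finite `S`, each `w ∈ W` is in `range (liftFinset T)` for some finite `T ⊇ S`
(the ranges exhaust `W` and are directed). [cite: FlathCorvallis1979, §2] [cite: Bump1997, §3.4] -/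
theorem exists_mem_range_liftFinset {S₀ : Finset ι} (h : IsRestrictedTensorProduct ℂ j S₀) (S : Finset ι) (w : W) :
    ∃ T : Finset ι, S ⊆ T ∧ w ∈ LinearMap.range (h.isRestrictedMultilinear.liftFinset T) := by
  have hdir : Directed (· ≤ ·) fun T : Finset ι => LinearMap.range (h.isRestrictedMultilinear.liftFinset T) :=
    fun T T' => ⟨T ∪ T', range_liftFinset_mono _ Finset.subset_union_left, range_liftFinset_mono _ Finset.subset_union_right⟩
  have hw : w ∈ ⨆ T : Finset ι, LinearMap.range (h.isRestrictedMultilinear.liftFinset T) := by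
    rw [h.iSup_range_liftFinset]; exact Submodule.mem_top
  obtain ⟨T, hT⟩ := (Submodule.mem_iSup_of_directed _ hdir).1 hw
  exact ⟨S ∪ T, Finset.subset_union_left, range_liftFinset_mono _ Finset.subset_union_right hT⟩

variable {G : ι → Type} [∀ i, Group (G i)] {K : ∀ i, Subgroup (G i)} (ρ : ∀ i, Representation ℂ (G i) (V i))
  {π : Representation ℂ (Πʳ i, [G i, K i]) W} {hx₀ : ∀ᶠ i in cofinite, x₀ i ∈ (ρ i).fixedPoints (K i)} {S₀ : Finset ι}

/-- **Equivariance on a finite piece**: if `g ∈ Πʳ G_i` has `g_i ∈ K_i` with `x₀ i` `K_i`-fixed for every `i ∉ T`, then `π(g) ∘ liftFinset T = liftFinset T ∘ (⊗_{i∈T} ρ_i)(g|_T)`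
(check on pure tensors: `g • extend T m = extend T (g|_T • m)`). [cite: FlathCorvallis1979, §2 Example 2] -/
theorem map_liftFinset_eq (h : IsRestrictedTensorProductRep ρ π hx₀ j S₀) (T : Finset ι) (g : Πʳ i, [G i, K i])
    (hg : ∀ i, i ∉ T → g i ∈ K i ∧ x₀ i ∈ (ρ i).fixedPoints (K i)) (y : ⨂[ℂ] i : T, V i) :
    π g (h.isRestrictedTensorProduct.isRestrictedMultilinear.liftFinset T y) =
      h.isRestrictedTensorProduct.isRestrictedMultilinear.liftFinset T (piTensorRep (fun i : T => ρ i) (fun i : T => g i) y) := by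
  suffices hmaps : π g ∘ₗ h.isRestrictedTensorProduct.isRestrictedMultilinear.liftFinset T =
      h.isRestrictedTensorProduct.isRestrictedMultilinear.liftFinset T ∘ₗ piTensorRep (fun i : T => ρ i) (fun i : T => g i) from LinearMap.congr_fun hmaps y
  refine PiTensorProduct.ext ?_
  ext m
  simp only [LinearMap.compMultilinearMap_apply, LinearMap.coe_comp, Function.comp_apply, piTensorRep_tprod, IsRestrictedMultilinear.liftFinset_tprod]
  rw [← h.map_smul g]
  congr 1
  ext i
  rw [RestrictedFamily.smul_apply]
  by_cases hi : i ∈ T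
  · rw [RestrictedFamily.extend_apply_of_mem _ _ hi, RestrictedFamily.extend_apply_of_mem _ _ hi]
  · rw [RestrictedFamily.extend_apply_of_notMem _ _ hi, RestrictedFamily.extend_apply_of_notMem _ _ hi]
    exact ((Representation.mem_fixedPoints _ _ _).1 (hg i hi).2) _ (hg i hi).1

end Bookkeeping

/-! ## §2 The fixed vectors of level `KF` ARE the finite tensor product `⨂_{i∈S} V_i^{K'_i}` -/

section Fixed

variable {ι : Type} [DecidableEq ι] {G : ι → Type} [∀ i, Group (G i)] {K : ∀ i, Subgroup (G i)}
  {V : ι → Type} [∀ i, AddCommGroup (V i)] [∀ i, Module ℂ (V i)] (ρ : ∀ i, Representation ℂ (G i) (V i)) {x₀ : ∀ i, V i}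
  {W : Type} [AddCommGroup W] [Module ℂ W] {π : Representation ℂ (Πʳ i, [G i, K i]) W}
  {hx₀ : ∀ᶠ i in cofinite, x₀ i ∈ (ρ i).fixedPoints (K i)} {j : RestrictedFamily V x₀ → W} {S₀ : Finset ι}
  (h : IsRestrictedTensorProductRep ρ π hx₀ j S₀) (S : Finset ι) (K' : ∀ i, Subgroup (G i))
  (hline : ∀ i, i ∉ S → (ρ i).fixedPoints (K i) = ℂ ∙ x₀ i)

/-- Membership in the level `KF = {g | g_i ∈ K'_i (i ∈ S), g_i ∈ K_i (i ∉ S)}`, written as the pullback of `Π_i L_i` (`L_i = K'_i` on `S`, `K_i` off `S`) along the coordinate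
map `Πʳ G_i → Π G_i` (Mathlib `RestrictedProduct.coeMonoidHom`). [folklore] -/
theorem mem_level_iff (g : Πʳ i, [G i, K i]) :
    g ∈ (Subgroup.pi Set.univ fun i => if i ∈ S then K' i else K i).comap
        (RestrictedProduct.coeMonoidHom : (Πʳ i, [G i, K i]) →* ∀ i, G i) ↔
      (∀ i ∈ S, g i ∈ K' i) ∧ ∀ i, i ∉ S → g i ∈ K i := by
  simp only [Subgroup.mem_comap, Subgroup.mem_pi, Set.mem_univ, true_implies]
  constructor
  · intro hg
    refine ⟨fun i hi => ?_, fun i hi => ?_⟩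
    · have := hg i; rwa [if_pos hi] at this
    · have := hg i; rwa [if_neg hi] at this
  · rintro ⟨h1, h2⟩ i
    by_cases hi : i ∈ S
    · rw [if_pos hi]; exact h1 i hi
    · rw [if_neg hi]; exact h2 i hi

include hline in
/-- **`j(⊗_{i∈S} w_i ⊗ ⊗_{i∉S} x₀_i)` is `KF`-fixed** for `w_i ∈ V_i^{K'_i}` (`i ∈ S`), the base vectors off `S` spanning the `K_i`-fixed lines: the range of
`liftFinset S ∘ fixedTensorMap` lies in `W^{KF}` (equivariance on the finite piece `S`, `map_liftFinset_eq`). [cite: FlathCorvallis1979, §2 Example 2] -/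
theorem liftFinset_fixedTensorMap_mem_fixedPoints (x : ⨂[ℂ] i : S, (ρ i).fixedPoints (K' i)) :
    h.isRestrictedTensorProduct.isRestrictedMultilinear.liftFinset S (fixedTensorMap (fun i : S => ρ i) (fun i : S => K' i) x) ∈
      π.fixedPoints ((Subgroup.pi Set.univ fun i => if i ∈ S then K' i else K i).comap
        (RestrictedProduct.coeMonoidHom : (Πʳ i, [G i, K i]) →* ∀ i, G i)) := by
  rw [Representation.mem_fixedPoints]
  intro g hg
  rw [mem_level_iff] at hg
  have hx₀K : ∀ i, i ∉ S → x₀ i ∈ (ρ i).fixedPoints (K i) := fun i hi => by rw [hline i hi]; exact Submodule.mem_span_singleton_self _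
  rw [map_liftFinset_eq ρ h S g (fun i hi => ⟨hg.2 i hi, hx₀K i hi⟩)]
  congr 1
  -- `g|_S ∈ Π_{i∈S} K'_i` fixes the image of `⨂ V_i^{K'_i}`
  have hgS : (fun i : S => g i) ∈ Subgroup.pi Set.univ (fun i : S => K' i) := (Subgroup.mem_pi _).2 fun i _ => hg.1 i i.2
  exact ((Representation.mem_fixedPoints _ _ _).1 (fixedTensorMap_mem_fixedPoints (fun i : S => ρ i) (fun i : S => K' i) x)) _ hgS

include hline in
/-- **Exhaustion at level `KF`**: every `KF`-fixed vector of `W` is `j(⊗_{i∈S} w_i ⊗ ⊗_{i∉S} x₀_i)` for some `⊗ w_i ∈ ⨂_{i∈S} V_i^{K'_i}` — it lies in ONE finite piece `T ⊇ S`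
(§1), is fixed there by `Π_{i∈T} L_i` (injectivity of `liftFinset T`, `S₀ ⊆ S ⊆ T`), hence comes from `⨂_{i∈T} V_i^{L_i}` (★ `fixedTensorExhaust_holds`), and the slots in `T ∖ S` are
the LINES `ℂ x₀_i`, absorbed into the scalar by multilinearity. [cite: FlathCorvallis1979, §2 Example 2] [cite: Bump1997, §3.4] -/
theorem exists_liftFinset_fixedTensorMap_eq (hS : S₀ ⊆ S) {w : W}
    (hw : w ∈ π.fixedPoints ((Subgroup.pi Set.univ fun i => if i ∈ S then K' i else K i).comap
        (RestrictedProduct.coeMonoidHom : (Πʳ i, [G i, K i]) →* ∀ i, G i))) :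
    ∃ x : ⨂[ℂ] i : S, (ρ i).fixedPoints (K' i),
      h.isRestrictedTensorProduct.isRestrictedMultilinear.liftFinset S (fixedTensorMap (fun i : S => ρ i) (fun i : S => K' i) x) = w := by
  classical
  set hj := h.isRestrictedTensorProduct.isRestrictedMultilinear with hhj
  have hx₀K : ∀ i, i ∉ S → x₀ i ∈ (ρ i).fixedPoints (K i) := fun i hi => by rw [hline i hi]; exact Submodule.mem_span_singleton_self _
  -- one finite piece `T ⊇ S` carrying `w`
  obtain ⟨T, hST, y, rfl⟩ := exists_mem_range_liftFinset h.isRestrictedTensorProduct S w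
  -- `y` is fixed by `Π_{i∈T} L_i`
  set L : ∀ i : T, Subgroup (G i) := fun i => if (i : ι) ∈ S then K' i else K i with hL
  have hy : y ∈ (piTensorRep fun i : T => ρ i).fixedPoints (Subgroup.pi Set.univ L) := by
    rw [Representation.mem_fixedPoints]
    intro gT hgT
    -- extend `gT` by `1` off `T`
    let g : Πʳ i, [G i, K i] := RestrictedProduct.mk (fun i => if hi : i ∈ T then gT ⟨i, hi⟩ else (1 : G i))
      (T.eventually_cofinite_notMem.mono fun i hi => by simp only [dif_neg hi]; exact one_mem (K i))
    have hgT' : ∀ i : T, g i = gT i := fun i => by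
      change (if hi : (i : ι) ∈ T then gT ⟨i, hi⟩ else (1 : G i)) = gT i
      rw [dif_pos i.2]
    have hg1 : ∀ i, i ∉ T → g i = 1 := fun i hi => by
      change (if hi : i ∈ T then gT ⟨i, hi⟩ else (1 : G i)) = 1
      rw [dif_neg hi]
    have hgKF : g ∈ (Subgroup.pi Set.univ fun i => if i ∈ S then K' i else K i).comap
        (RestrictedProduct.coeMonoidHom : (Πʳ i, [G i, K i]) →* ∀ i, G i) := by
      rw [mem_level_iff]
      refine ⟨fun i hi => ?_, fun i hi => ?_⟩
      · have h1 := (Subgroup.mem_pi _).1 hgT ⟨i, hST hi⟩ (Set.mem_univ _)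
        rw [hL] at h1; simp only [if_pos hi] at h1
        rwa [hgT' ⟨i, hST hi⟩]
      · by_cases hiT : i ∈ T
        · have h1 := (Subgroup.mem_pi _).1 hgT ⟨i, hiT⟩ (Set.mem_univ _)
          rw [hL] at h1; simp only [if_neg hi] at h1
          rwa [hgT' ⟨i, hiT⟩]
        · rw [hg1 i hiT]; exact one_mem _
    have hfix := ((Representation.mem_fixedPoints _ _ _).1 hw) g hgKF
    rw [map_liftFinset_eq ρ h T g (fun i hi => ⟨by rw [hg1 i hi]; exact one_mem _, hx₀K i fun hiS => hi (hST hiS)⟩)] at hfix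
    have hinj := h.isRestrictedTensorProduct.injective_liftFinset (hS.trans hST)
    have hfix' := hinj hfix
    have hgg : (fun i : T => g i) = gT := funext hgT'
    rwa [hgg] at hfix'
  -- so `y = fixedTensorMap z`, `z ∈ ⨂_{i∈T} V_i^{L_i}`
  obtain ⟨z, rfl⟩ := fixedTensorExhaust_holds (fun i : T => ρ i) L hy
  -- each such image lies in the range of `liftFinset S ∘ fixedTensorMap`
  suffices hz : ∀ z : ⨂[ℂ] i : T, (ρ i).fixedPoints (L i),
      hj.liftFinset T (fixedTensorMap (fun i : T => ρ i) L z) ∈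
        LinearMap.range (hj.liftFinset S ∘ₗ fixedTensorMap (fun i : S => ρ i) (fun i : S => K' i)) by
    obtain ⟨x, hx⟩ := hz z
    exact ⟨x, hx⟩
  intro z
  induction z using PiTensorProduct.induction_on with
  | smul_tprod c u =>
    rw [map_smul, map_smul]
    refine Submodule.smul_mem _ c ?_
    -- off `S` the components are on the lines `ℂ x₀_i`
    have hc : ∀ i : T, (i : ι) ∉ S → ∃ a : ℂ, a • x₀ i = (u i : V i) := fun i hi => by
      have hu : (u i : V i) ∈ (ρ i).fixedPoints (K i) := by
        have h2 : (u i : V i) ∈ (ρ i).fixedPoints (if (i : ι) ∈ S then K' i else K i) := (u i).2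
        rwa [if_neg hi] at h2
      rw [hline i hi] at hu
      exact Submodule.mem_span_singleton.1 hu
    choose! a ha using hc
    let d : T → ℂ := fun i => if (i : ι) ∈ S then 1 else a i
    let u' : ∀ i : T, V i := fun i => if (i : ι) ∈ S then (u i : V i) else x₀ i
    have hud : (fun i : T => (u i : V i)) = fun i => d i • u' i := by
      funext i
      by_cases hi : (i : ι) ∈ S
      · simp only [d, u', if_pos hi, one_smul]
      · simp only [d, u', if_neg hi, ha i hi]
    rw [fixedTensorMap_tprod, hud, MultilinearMap.map_smul_univ, map_smul]
    refine Submodule.smul_mem _ _ ?_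
    -- `⊗_{i∈T} u'_i = pad of ⊗_{i∈S} u_i`
    have hpad : u' = fun i : T => if hi : (i : ι) ∈ S then ((fun i : S => (u ⟨i, hST i.2⟩ : V i)) ⟨i, hi⟩) else x₀ i := by
      funext i
      by_cases hi : (i : ι) ∈ S
      · simp only [u', if_pos hi, dif_pos hi]
      · simp only [u', if_neg hi, dif_neg hi]
    rw [IsRestrictedMultilinear.liftFinset_tprod, hpad, ← extend_eq_extend_pad hST (fun i : S => (u ⟨i, hST i.2⟩ : V i)),
      ← hj.liftFinset_tprod S (fun i : S => (u ⟨i, hST i.2⟩ : V i))]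
    refine ⟨tprod ℂ fun i : S => (⟨(u ⟨i, hST i.2⟩ : V i), ?_⟩ : (ρ i).fixedPoints (K' i)), ?_⟩
    · have h2 : (u ⟨i, hST i.2⟩ : V i) ∈ (ρ i).fixedPoints (if (i : ι) ∈ S then K' i else K i) := (u ⟨i, hST i.2⟩).2
      rwa [if_pos i.2] at h2
    · rw [LinearMap.comp_apply, fixedTensorMap_tprod]
  | add x y hx hy =>
    rw [map_add, map_add]
    exact Submodule.add_mem _ hx hy

include hline in
/-- **`Φ : ⨂_{i∈S} V_i^{K'_i} ≃ₗ W^{KF}`** — `liftFinset S ∘ fixedTensorMap`, corestricted: injective (★ injectivity of `liftFinset S`, `S ⊇ S₀`, and of `fixedTensorMap`) and onto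
(`exists_liftFinset_fixedTensorMap_eq`); delivered with its formula on vectors. [cite: FlathCorvallis1979, §2 Example 2] [cite: Bump1997, §3.4] -/
theorem exists_fixedEquiv (hS : S₀ ⊆ S) :
    ∃ Φ : (⨂[ℂ] i : S, (ρ i).fixedPoints (K' i)) ≃ₗ[ℂ]
        π.fixedPoints ((Subgroup.pi Set.univ fun i => if i ∈ S then K' i else K i).comap
          (RestrictedProduct.coeMonoidHom : (Πʳ i, [G i, K i]) →* ∀ i, G i)),
      ∀ x, (Φ x : W) = h.isRestrictedTensorProduct.isRestrictedMultilinear.liftFinset S (fixedTensorMap (fun i : S => ρ i) (fun i : S => K' i) x) := by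
  refine ⟨LinearEquiv.ofBijective
      (((h.isRestrictedTensorProduct.isRestrictedMultilinear.liftFinset S) ∘ₗ fixedTensorMap (fun i : S => ρ i) (fun i : S => K' i)).codRestrict _
        fun x => liftFinset_fixedTensorMap_mem_fixedPoints ρ h S K' hline x)
      ⟨fun x y hxy => ?_, fun w => ?_⟩, fun x => rfl⟩
  · have h1 := congrArg Subtype.val hxy
    exact fixedTensorMap_injective _ _ (h.isRestrictedTensorProduct.injective_liftFinset hS h1)
  · obtain ⟨x, hx⟩ := exists_liftFinset_fixedTensorMap_eq ρ h S K' hline hS w.2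
    exact ⟨x, Subtype.ext hx⟩

end Fixed


end Summit.HodgeConjecture.HodgeConjecture.Cruxes.H413.K2E1RestrictedTensorFixedLevel

end
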